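import Mathlib

/-!
# T-S5.13A/13E exponent feasibility — a parameter point `(κ₃, ε₁)` for every `0 < θ < 5/64` (ASSEMBLY-S5 §1 with the rarity-entropy constraint `2θ < ε₁`;
# LINE-19 S5 ⟨stmt-QuantumFields-24004⟩/⟨24335⟩)

Width seat `ym-line-sfw-p2-w2` (g31).  The relative Steps A–C (✓`BoxToChart.boxPlaqCov_sub_chartCov_relative`) and the §5/§6 sup and moment bounds
of Steps D–E need exponents with

  `θ/2 < κ₃ < (1/2 − 4θ)/3`,  `κ₃ < ε₁`,  `2θ < ε₁ < 1/2 − 4θ`,  `ε₁ < 1/2 − 6θ + 2κ₃`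

(the constraint `2θ < ε₁` is the entropy of the Gibbs union bound ✓`boxState_largeField_rarity`, absent from ASSEMBLY-S5 §1 rev 25e028c94ec6; with it the
system is feasible iff `θ < 5/64` — in particular at the skeleton's `θL = 1/13`).  `exists_exponents` gives the explicit point
`ε₁ = θ + 5/64`, `κ₃ = (max(θ/2, 7θ/2 − 27/128) + min(θ + 5/64, (1/2 − 4θ)/3))/2`.

Everything proved, Mathlib only; no definitions.  HONEST LABEL: bookkeeping for the T-S5.13 assembly of the XL stub S5 of a critic-PASSed DRAFT line;
S5, U5, ⟨24004⟩ ⟨24335⟩ ⟨24336⟩ remain OPEN; no crux, rung or summit is proved; **the Yang–Mills mass gap is NOT proved by this file.**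
-/

set_option autoImplicit false

namespace Summit.QuantumFields.YangMills.Theorems.AllWindowsColdBoxBoxHighLine

namespace BoxToChart

/-- ★ **Exponent feasibility for `0 < θ < 5/64`**: some `(κ₃, ε₁)` satisfies all six constraints of ASSEMBLY-S5 §1 plus `2θ < ε₁`. -/
theorem exists_exponents {θ : ℝ} (hθ : 0 < θ) (hθ' : θ < 5 / 64) :
    ∃ κ₃ ε₁ : ℝ, θ / 2 < κ₃ ∧ κ₃ < (1 / 2 - 4 * θ) / 3 ∧ κ₃ < ε₁ ∧ 2 * θ < ε₁ ∧ ε₁ < 1 / 2 - 4 * θ ∧ ε₁ < 1 / 2 - 6 * θ + 2 * κ₃ := by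
  have hℓυ : max (θ / 2) (7 * θ / 2 - 27 / 128) < min (θ + 5 / 64) ((1 / 2 - 4 * θ) / 3) :=
    lt_min (max_lt (by linarith) (by linarith)) (max_lt (by linarith) (by linarith))
  have h1 : θ / 2 ≤ max (θ / 2) (7 * θ / 2 - 27 / 128) := le_max_left _ _
  have h2 : 7 * θ / 2 - 27 / 128 ≤ max (θ / 2) (7 * θ / 2 - 27 / 128) := le_max_right _ _
  have h3 : min (θ + 5 / 64) ((1 / 2 - 4 * θ) / 3) ≤ θ + 5 / 64 := min_le_left _ _
  have h4 : min (θ + 5 / 64) ((1 / 2 - 4 * θ) / 3) ≤ (1 / 2 - 4 * θ) / 3 := min_le_right _ _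
  refine ⟨(max (θ / 2) (7 * θ / 2 - 27 / 128) + min (θ + 5 / 64) ((1 / 2 - 4 * θ) / 3)) / 2, θ + 5 / 64, ?_, ?_, ?_, ?_, ?_, ?_⟩ <;>
    linarith

/-- The six constraints imply `12θ < 1` (and hence every weaker window condition of ASSEMBLY-S5). -/
theorem twelve_mul_lt_one_of_exponents {θ ε₁ : ℝ} (hε₁θ : 2 * θ < ε₁) (hε₁u : ε₁ < 1 / 2 - 4 * θ) : 12 * θ < 1 := by
  linarith

/-! ## Appended (w2 g32, 2026-08-29): the U5 window `θ < 1/10` (U5 prep, helper; U5 ⟨stmt-QuantumFields-24336⟩ OPEN; the Yang–Mills mass gap is NOT proved)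

After the lifts L1 (✓`OrbitJacobian.orbitNormaliserJacobian_sup`, window `8θ < 1`), U2 in Step A (✓`BoxToChart.boxPlaqCov_sub_chartCov_le_window_sup`,
premise `ε₁ < 1/2 − 3θ`) and L5 (T-S5.6′, `5θ + ε₁ − 1/2 < 2κ₃`) the constraints of the relative Steps A–C (✓`BoxToChart.boxPlaqCov_sub_chartCov_relative_sup`)
together with the post-L4 sup constraints (K2) `6θ + 2κ₃ < 1`, `2θ − 1/2 + κ₃ < 0` of Steps D–E (planner ym-idea-2 g18, `U5-BLOCKERS.md` §2 L4) are
feasible for EVERY `0 < θ < 1/10`, with the explicit point `κ₃ = 2θ`, `ε₁ = 1/4 − θ/2`. -/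

/-- ★ **Exponent feasibility at the U5 window `0 < θ < 1/10`**: the point `κ₃ = 2θ`, `ε₁ = 1/4 − θ/2` satisfies the Steps A–C constraints of
✓`boxPlaqCov_sub_chartCov_relative_sup` (`θ/2 < κ₃ < ε₁`, `2θ < ε₁ < 1/2 − 3θ`, `5θ + ε₁ − 1/2 < 2κ₃`) and the post-L4 sup constraints (K2)
(`6θ + 2κ₃ < 1`, `2θ − 1/2 + κ₃ < 0`). -/
theorem exists_exponents_sup {θ : ℝ} (hθ : 0 < θ) (hθ' : θ < 1 / 10) :
    ∃ κ₃ ε₁ : ℝ, θ / 2 < κ₃ ∧ κ₃ < ε₁ ∧ 2 * θ < ε₁ ∧ ε₁ < 1 / 2 - 3 * θ ∧ 5 * θ + ε₁ - 1 / 2 < 2 * κ₃ ∧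
      6 * θ + 2 * κ₃ < 1 ∧ 2 * θ - 1 / 2 + κ₃ < 0 := by
  refine ⟨2 * θ, 1 / 4 - θ / 2, ?_, ?_, ?_, ?_, ?_, ?_, ?_⟩ <;> linarith

/-- The Steps A–C constraints at the U5 window force `θ < 1/10` (so the window of ✓`boxPlaqCov_sub_chartCov_relative_sup` is exactly U5's). -/
theorem lt_one_tenth_of_exponents_sup {θ ε₁ : ℝ} (hε₁θ : 2 * θ < ε₁) (hε₁u : ε₁ < 1 / 2 - 3 * θ) : θ < 1 / 10 := by
  linarith

/-! ## Appended (w2 g33, 2026-08-29/30): the FULL third-order constraint set at the U5 window `θ < 1/10` (U5 prep, helper; U5 ⟨stmt-QuantumFields-24336⟩ OPEN; the Yang–Mills mass gap is NOT proved)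

The point `κ₃ = 2θ` of `exists_exponents_sup` serves Steps A–C, but the Steps D–E of the THIRD-order assembly (planner ym-idea-2 g18,
`Cruxes/BoxWindowHighSU2213/ASSEMBLY-U5.md` v0.2 §1/§3) add three more `κ₃`-constraints: the cut-set sup bound of the tilt exponent
(✓`TiltSup.exists_forall_abs_tiltU_le_on_cubicCut`: `4θ + 4κ₃ < 1`, `6θ + 2κ₃ < 1`) and the domination bracket of the cubic cut inside the FP weight
re-based on the two-form Gaussians (planner note (N1) 2026-08-29T23:29:43Z: `exp(C·s·H⁴·(1+log H)) ≤ e` needs (K4) `κ₃ + 4θ < 1/2`), which `κ₃ = 2θ` violates for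
`θ ≥ 1/12`.  The point `κ₃ = 1/8 − θ/4`, `ε₁ = 1/4 − θ/2` satisfies ALL of (K1)–(K4), (E1)–(E3) and the two sup constraints for EVERY `0 < θ < 1/10`
(at `θ → 1/10⁻` both `κ₃` and the (E3)/(K4) margins tend to `1/10` resp. `0`: hairline, large `β₀` only), and the enlarged system still forces exactly `θ < 1/10`. -/

/-- ★ **Full third-order exponent feasibility at the U5 window `0 < θ < 1/10`**: the explicit point `κ₃ = 1/8 − θ/4`, `ε₁ = 1/4 − θ/2` (returned
together with its defining equations, so that budget rows can `rw` them) satisfies the Steps A–C constraints of ✓`boxPlaqCov_sub_chartCov_relative_sup`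
(`θ/2 < κ₃ < ε₁`, `2θ < ε₁ < 1/2 − 3θ`, `5θ + ε₁ − 1/2 < 2κ₃`), the post-L4 sup constraints (`6θ + 2κ₃ < 1`, `2θ − 1/2 + κ₃ < 0`, `4θ + 4κ₃ < 1`),
the cubic-cut bracket constraint (K4) `κ₃ + 4θ < 1/2`, and `0 < κ₃ < 1/8`. -/
theorem exists_exponents_third {θ : ℝ} (hθ : 0 < θ) (hθ' : θ < 1 / 10) :
    ∃ κ₃ ε₁ : ℝ, κ₃ = 1 / 8 - θ / 4 ∧ ε₁ = 1 / 4 - θ / 2 ∧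
      θ / 2 < κ₃ ∧ κ₃ < ε₁ ∧ 2 * θ < ε₁ ∧ ε₁ < 1 / 2 - 3 * θ ∧ 5 * θ + ε₁ - 1 / 2 < 2 * κ₃ ∧
      6 * θ + 2 * κ₃ < 1 ∧ 2 * θ - 1 / 2 + κ₃ < 0 ∧ 4 * θ + 4 * κ₃ < 1 ∧ κ₃ + 4 * θ < 1 / 2 ∧ 0 < κ₃ ∧ κ₃ < 1 / 8 := by
  refine ⟨1 / 8 - θ / 4, 1 / 4 - θ / 2, rfl, rfl, ?_, ?_, ?_, ?_, ?_, ?_, ?_, ?_, ?_, ?_, ?_⟩ <;> linarith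

/-- The enlarged constraint set does not shrink the window: `2θ < ε₁`, (E3) `5θ + ε₁ − 1/2 < 2κ₃` and (K4) `κ₃ + 4θ < 1/2` already force `θ < 1/10`
(so adding the cubic-cut bracket constraint to Steps A–C costs nothing below `1/10`). -/
theorem lt_one_tenth_of_exponents_third {θ κ₃ ε₁ : ℝ} (hε₁θ : 2 * θ < ε₁) (hε₁u' : 5 * θ + ε₁ - 1 / 2 < 2 * κ₃) (hκ4 : κ₃ + 4 * θ < 1 / 2) :
    θ < 1 / 10 := by
  linarith

end BoxToChart

end Summit.QuantumFields.YangMills.Theorems.AllWindowsColdBoxBoxHighLine
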